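import Summits.QuantumAdvantage.QuantumAdvantage.Theses.ModularRank
import Literature.Computability.QuantumComplexity.StabilizerRankOver

/-!
# Route `ModularRank`: the glue item `ModularRankPolyOfSplit` (stmt-QuantumAdvantage-17859) — PROOF

`ModularRankPolyOfSplit := DenseModularDecomposer → DecomposerListingPolyTime → ModularRankPoly`
(strategist split of the deciding crux, 2026-08-17). Theorems-ready: imports only the route file,
proves the item BY NAME (+ the kill edge `not_denseModularDecomposer_of_superpoly : ModularRankSuperpoly → ¬DenseModularDecomposer` over the route decls, landable `--supports stmt-QuantumAdvantage-17857`); identical mathematics to `Cruxes/ModularRankPoly/Split.lean`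
(`Split.ModularRankPoly_of_subs`). A prover lands this file verbatim as
`Summits/QuantumAdvantage/QuantumAdvantage/Theorems/ModularRankModularRankPolyOfSplit.lean`
with `--workitem stmt-QuantumAdvantage-17859` (planner seats cannot write Theorems/).

Proof: the oracle `D t k` is the listing of piece 2 over the recogniser/decomposer of piece 1;
polynomial time is piece 2 verbatim; distinct primes = `Nodup` of a filtered `range`; `≥ k` blocks =
density; per block: primality / residue / root / T-freeness from pieces, `t^c + c ≤ (t+k)^c + c`,
and the identity moved from `modGateEval` to the route's inline evaluation gate by gate.
-/

set_option linter.dupNamespace false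

namespace Summit.QuantumAdvantage.QuantumAdvantage.Theses.ModularRank

/-- Congruence helper for the assembly: replacing the gate dictionary `f` by any `g` that agrees
with it on the gates actually occurring in the word does not change `a • (∏ gates) e₀`. -/
theorem smul_prodMap_mulVec_congr {t : ℕ} {R : Type} [CommRing R] (a : R)
    (gates : List (Literature.Computability.Cryptography.QGate Literature.Computability.Cryptography.cliffordT t))
    (f g : Literature.Computability.Cryptography.QGate Literature.Computability.Cryptography.cliffordT t →
      Matrix (Literature.Computability.Cryptography.QReg t) (Literature.Computability.Cryptography.QReg t) R)
    (v : Literature.Computability.Cryptography.QReg t → R) (h : ∀ q ∈ gates, f q = g q) :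
    a • ((gates.map f).reverse.prod).mulVec v = a • ((gates.map g).reverse.prod).mulVec v := by
  rw [List.map_congr_left h]

set_option maxHeartbeats 800000 in
/-- ASSEMBLY (sufficiency of the split): `DenseModularDecomposer → DecomposerListingPolyTime →
ModularRankPoly`. The oracle `D t k` of `ModularRankPoly` is the listing of piece 2 built from the
recogniser/decomposer of piece 1; polynomial time is piece 2 verbatim; distinct primes, `≥ k`
blocks and the per-block clauses are list bookkeeping plus `t^c + c ≤ (t+k)^c + c` and the bridge
`modGateEval_eq_inline` from the named dictionary to the route's inline evaluation. -/
theorem modularRankPolyOfSplit : ModularRankPolyOfSplit := by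
  intro h₁ h₂
  obtain ⟨c, d, P, F, hP, hF, hdens, hspec⟩ := h₁
  -- the oracle: list the good primes below the density bound, each with its root and decomposition
  refine ⟨fun t k => ((List.range ((t + k) ^ d + d)).filter fun p => decide (p.Prime ∧ p % 8 = 1 ∧ P t p = true)).map fun p => (p, F t p), ?_, c, fun t k => ⟨?_, ?_, ?_⟩⟩
  · -- polynomial time: piece 2 verbatim
    exact h₂ d P F hP hF
  · -- the listed primes are distinct
    rw [List.map_map]
    have hcomp : (Prod.fst ∘ fun p : ℕ => (p, F t p)) = id := funext fun _ => rfl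
    rw [hcomp, List.map_id]
    exact List.nodup_range.filter _
  · -- at least k blocks: the density clause of piece 1
    rw [List.length_map]
    exact hdens t k
  · -- per-block clauses
    intro b hb
    obtain ⟨p, hp, rfl⟩ := List.mem_map.1 hb
    obtain ⟨-, hp⟩ := List.mem_filter.1 hp
    obtain ⟨hprime, hmod, hgood⟩ := of_decide_eq_true hp
    obtain ⟨hroot, hlen, htf, hid⟩ := hspec t p hprime hmod hgood
    refine ⟨hprime, hmod, hroot, ?_, htf, ?_⟩
    · -- t^c + c ≤ (t+k)^c + c
      calc (F t p).2.length ≤ t ^ c + c := hlen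
        _ ≤ (t + k) ^ c + c := by
          have := Nat.pow_le_pow_left (Nat.le_add_right t k) c
          omega
    · -- the decomposition identity, bridged to the route's inline evaluation gate by gate
      dsimp only
      refine hid.trans (congrArg List.sum (List.map_congr_left fun x hx => ?_))
      have hT := (htf x hx).2
      rw [Literature.Computability.Cryptography.QCircuit.tCount_eq_zero_iff] at hT
      unfold Literature.Computability.QuantumComplexity.modGateEval
      refine smul_prodMap_mulVec_congr _ _ _ _ _ fun q hq => ?_
      cases q with
      | gate g e =>
        cases g
        · rfl
        · rfl
        · exact absurd rfl (hT _ hq e)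
        · rfl
      | oracle k e => rfl

set_option maxHeartbeats 800000 in
/-- THE KILL PATH SURVIVES THE SPLIT: the route's S-side kill item `ModularRankSuperpoly`
(stmt-QuantumAdvantage-1793: for every `c` some `t ≥ 2` at which EVERY prime `p ≡ 1 (mod 8)`, every
root and every modular decomposition need more than `t^c + c` terms) refutes the arithmetic piece
directly — density at `k = 1` supplies one good prime below `(t+1)^d + d`, whose decomposer output
has `≤ t^c + c` terms (same exponent, no juggling; the parent needed `c ↦ 2c`, `SuperpolyKillsPoly`).
So after the split the route still closes `refuted:DenseModularDecomposer` from a Theorems proof of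
`ModularRankSuperpoly`, exactly as designed for the parent. -/
theorem not_denseModularDecomposer_of_superpoly (hS : ModularRankSuperpoly) :
    ¬ DenseModularDecomposer := by
  rintro ⟨c, d, P, F, -, -, hdens, hspec⟩
  obtain ⟨t, -, ht⟩ := hS c
  -- one good prime from density at k = 1
  have hlenpos : 0 < ((List.range ((t + 1) ^ d + d)).filter fun p =>
      decide (p.Prime ∧ p % 8 = 1 ∧ P t p = true)).length := hdens t 1
  obtain ⟨p, hp⟩ := List.exists_mem_of_length_pos hlenpos
  obtain ⟨-, hp⟩ := List.mem_filter.1 hp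
  obtain ⟨hprime, hmod, hgood⟩ := of_decide_eq_true hp
  obtain ⟨hroot, hlen, htf, hid⟩ := hspec t p hprime hmod hgood
  have hsp := ht p hprime hmod ((F t p).1 : ZMod p) hroot
  dsimp only at hsp
  have hL := hsp ((F t p).2.map fun x => (x.1, (x.2 : ZMod p))) ?_ ?_
  · rw [List.length_map] at hL
    omega
  · -- T-freeness is preserved by recasting the coefficients
    intro x hx
    obtain ⟨y, hy, rfl⟩ := List.mem_map.1 hx
    exact htf y hy
  · -- the identity, recast and bridged to the inline evaluation gate by gate
    rw [List.map_map]
    refine hid.trans (congrArg List.sum (List.map_congr_left fun x hx => ?_))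
    simp only [Function.comp_apply]
    have hT := (htf x hx).2
    rw [Literature.Computability.Cryptography.QCircuit.tCount_eq_zero_iff] at hT
    unfold Literature.Computability.QuantumComplexity.modGateEval
    refine smul_prodMap_mulVec_congr _ _ _ _ _ fun q hq => ?_
    cases q with
    | gate g e =>
      cases g
      · rfl
      · rfl
      · exact absurd rfl (hT _ hq e)
      · rfl
    | oracle k e => rfl

end Summit.QuantumAdvantage.QuantumAdvantage.Theses.ModularRank
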